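import Mathlib
import Summits.Ventures.PercRepro2.Defs
import Summits.Ventures.PercRepro2.Graph
import Summits.Ventures.PercRepro2.Harris
import Summits.Ventures.PercRepro2.Exploration
import Summits.Ventures.PercRepro2.Events
import Summits.Ventures.PercRepro2.RowC1Star

/-!
# Equivalent forms of (★) (blind cell PercRepro2, p2 g32; proofs/P2-G32-STAR.md §7)

With `Q = {a₁ ↮ a₂}`, `oU = {o ∈ C(a₁) ∪ C(a₂)}`, `oN = Q ∖ oU` (o rootless) and `K_i = C_{G−o}(a_i)`:

  (★)  ⟺  **P(Q, o∈U) · P(Q, o∉U, b∈K₂) ≤ P(Q, o∈U, b∈K₁) · P(Q) + P(Q, o∉U) · P(Q, o∈U, b∈K₂)**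

(`starNonneg_iff`), i.e. `μ(oN)μ(oU)·[μ(b∈K₂ | oN) − μ(b∈K₂ | oU)] ≤ μ(oU, b∈K₁)`: the excess probability
of `b ∈ K₂` when `o` is rootless over when `o` is rooted is bounded by the type-II mass.  The
ingredients are additivity and `b ∈ K₁ ∩ K₂ ⟹ a₁ ↔ a₂` (`not_Q_of_mem_connDel_both`).  Std axioms.
-/

namespace Summit.Ventures.PercRepro2

namespace RowC1

section StarForms

open Classical

variable {V : Type*} {E : Type*} [Fintype E] [DecidableEq E] [Fintype V] [DecidableEq V]
  {R : Type*} [CommRing R] [LinearOrder R] [IsStrictOrderedRing R]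

omit [Fintype E] [DecidableEq E] in
/-- `b ∈ K₁ ∩ K₂` (in `G − o`) forces `a₁ ↔ a₂`. -/
lemma conn_of_mem_connDel_both {ends : E → Sym2 V} {ω : Config E} {o a₁ a₂ b : V}
    (h₁ : ω ∈ connDelEvent ends {o} b a₁) (h₂ : ω ∈ connDelEvent ends {o} b a₂) :
    Conn ends ω a₁ a₂ :=
  conn_trans (conn_symm (connDelEvent_subset_connEvent ends {o} b a₁ h₁))
    (connDelEvent_subset_connEvent ends {o} b a₂ h₂)

/-- **(★) in covariance form**: `StarNonneg` is equivalent to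
`P(Q, oU)·P(Q, oN, b∈K₂) ≤ P(Q, oU, b∈K₁)·P(Q) + P(Q, oN)·P(Q, oU, b∈K₂)`. -/
theorem starNonneg_iff (p : E → R) (ends : E → Sym2 V) (a₁ a₂ o b : V) :
    StarNonneg p ends a₁ a₂ o b ↔
    prob p ((connEvent ends a₁ o ∪ connEvent ends a₂ o) ∩ (connEvent ends a₁ a₂)ᶜ) *
        prob p ((connEvent ends a₁ o ∪ connEvent ends a₂ o)ᶜ ∩ connDelEvent ends {o} b a₂ ∩
          (connEvent ends a₁ a₂)ᶜ) ≤
      prob p ((connEvent ends a₁ o ∪ connEvent ends a₂ o) ∩ connDelEvent ends {o} b a₁ ∩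
          (connEvent ends a₁ a₂)ᶜ) * prob p (connEvent ends a₁ a₂)ᶜ +
        prob p ((connEvent ends a₁ o ∪ connEvent ends a₂ o)ᶜ ∩ (connEvent ends a₁ a₂)ᶜ) *
          prob p ((connEvent ends a₁ o ∪ connEvent ends a₂ o) ∩ connDelEvent ends {o} b a₂ ∩
            (connEvent ends a₁ a₂)ᶜ) := by
  unfold StarNonneg
  set Q : Set (Config E) := (connEvent ends a₁ a₂)ᶜ with hQ
  set oU : Set (Config E) := connEvent ends a₁ o ∪ connEvent ends a₂ o with hoU
  set K₁ : Set (Config E) := connDelEvent ends {o} b a₁ with hK₁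
  set K₂ : Set (Config E) := connDelEvent ends {o} b a₂ with hK₂
  -- disjointness: `K₁ ∩ K₂ ∩ Q = ∅`
  have hdisj : ∀ ω, ω ∈ K₁ → ω ∈ K₂ → ω ∉ Q := fun ω h₁ h₂ hq =>
    hq (conn_of_mem_connDel_both h₁ h₂)
  -- partitions
  have p1 := prob_inter_add_prob_inter_compl p (oU ∩ Q) K₂
  have p2 := prob_inter_add_prob_inter_compl p (oU ∩ Q ∩ K₂ᶜ) K₁
  have p3 := prob_inter_add_prob_inter_compl p Q oU
  have p4 := prob_inter_add_prob_inter_compl p Q K₂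
  have p5 := prob_inter_add_prob_inter_compl p (Q ∩ K₂) oU
  have s1 : oU ∩ Q ∩ K₂ᶜ ∩ K₁ = oU ∩ K₁ ∩ Q := by
    ext ω
    simp only [Set.mem_inter_iff, Set.mem_compl_iff]
    constructor
    · rintro ⟨⟨⟨h1, h2⟩, _⟩, h4⟩
      exact ⟨⟨h1, h4⟩, h2⟩
    · rintro ⟨⟨h1, h4⟩, h2⟩
      exact ⟨⟨⟨h1, h2⟩, fun h3 => hdisj ω h4 h3 h2⟩, h4⟩
  have s2 : oU ∩ Q ∩ K₂ᶜ ∩ K₁ᶜ = oU ∩ (K₁ᶜ ∩ K₂ᶜ) ∩ Q := by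
    ext ω
    simp only [Set.mem_inter_iff, Set.mem_compl_iff]
    tauto
  have s3 : oU ∩ Q ∩ K₂ = oU ∩ K₂ ∩ Q := by
    ext ω
    simp only [Set.mem_inter_iff]
    tauto
  have s4 : Q ∩ K₂ ∩ oU = oU ∩ K₂ ∩ Q := by
    ext ω
    simp only [Set.mem_inter_iff]
    tauto
  have s5 : Q ∩ K₂ ∩ oUᶜ = oUᶜ ∩ K₂ ∩ Q := by
    ext ω
    simp only [Set.mem_inter_iff, Set.mem_compl_iff]
    tauto
  have s6 : Q ∩ oUᶜ = oUᶜ ∩ Q := Set.inter_comm _ _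
  have s7 : Q ∩ oU = oU ∩ Q := Set.inter_comm _ _
  have s8 : Q ∩ K₂ᶜ = K₂ᶜ ∩ Q := Set.inter_comm _ _
  rw [s3] at p1
  rw [s1, s2] at p2
  rw [s7, s6] at p3
  rw [s8] at p4
  rw [s4, s5] at p5
  -- names
  set N := prob p Q
  set a := prob p (oU ∩ Q)
  set n := prob p (oUᶜ ∩ Q)
  set A₁ := prob p (oU ∩ K₁ ∩ Q)
  set A₂ := prob p (oU ∩ K₂ ∩ Q)
  set A₃ := prob p (oU ∩ (K₁ᶜ ∩ K₂ᶜ) ∩ Q)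
  set B := prob p (K₂ᶜ ∩ Q)
  set N₂ := prob p (oUᶜ ∩ K₂ ∩ Q)
  set X := prob p (oU ∩ Q ∩ K₂ᶜ)
  set Y := prob p (Q ∩ K₂)
  -- identities: X = A₁ + A₃, a = A₂ + X, N = a + n, N = Y + B, Y = A₂ + N₂
  have e1 : A₃ * N = a * N - A₂ * N - A₁ * N := by
    have : A₃ = a - A₂ - A₁ := by linarith
    rw [this]; ring
  have e2 : a * B = a * N - a * A₂ - a * N₂ := by
    have : B = N - A₂ - N₂ := by linarith
    rw [this]; ring
  have e3 : A₂ * n = A₂ * N - A₂ * a := by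
    have : n = N - a := by linarith
    rw [this]; ring
  constructor
  · intro h
    nlinarith [h, e1, e2, e3]
  · intro h
    nlinarith [h, e1, e2, e3]

end StarForms

end RowC1

end Summit.Ventures.PercRepro2
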